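import Literature.Barriers.AnomalousDissipation.GravestModeLaminarAttractorGalerkin
import HarnessLib

/-!
# The single-shell pincer at the Galerkin level: Tran–Shepherd's dynamical constraint
(barrier-audit proof file of `Literature/Barriers/AnomalousDissipation/GravestModeLaminarAttractor`,
D-0021 audit 2026-08-15, generation 6; companion of the first-shell decay
`galerkin_excess_le_mul_exp` of the Galerkin sibling)

Marchioro's argument (FMRT 2001, App. III.A.4, (A.32)) subtracts `λ₁ ×` the energy equation from
the enstrophy equation. Nothing in it is tied to the FIRST shell: for a force valued in ANY single
eigenspace `E_λ` of the Stokes operator on `𝕋²` (`λ = 4π²m`, Fourier support on `|k|² = m`),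
`(f, Au) = λ(f, u)` and `(B(u,u), Au) = (B(u,u), u) = 0`, so the *signed* shell excess
`ξ = ‖u‖² - λ|u|² = ∑_k 4π²(|k|² - m)|û_k|²` obeys
`½ ξ' = -ν ∑_k 4π²|k|² · 4π²(|k|² - m)|û_k|² ≤ -νλ ξ` (termwise `(λ_k - λ)² ≥ 0`), whence
`ξ(t) ≤ ξ(s) e^{-2νλ(t-s)}`: positive values are dissipated away and non-positive values stay
non-positive — Tran–Shepherd's "dynamical constraint" `‖u‖² ≤ λ|u|²` on the attractor
(Physica D 165 (2002) 199–212 = arXiv:nlin/0201002, §4, eq. (ξ) and (constraint); after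
Constantin–Foias–Manley, Phys. Fluids 6 (1994) 427; mean form `ε ≤ νk_f²U²`, `χ ≤ νk_f⁴U²` in
Alexakis–Doering, Phys. Lett. A 359 (2006), §4). For `m = 1` one recovers (A.32)–(A.33)
(`ξ ≥ 0` by Poincaré for mean-free fields). This file proves the statement **at the Galerkin
level** of the tree (`Torus.galerkinField`, `Torus.galerkinRHS`), for every real level `m`
and every `ν ≥ 0`, with no sign condition on `ξ`:

* `sum_shellWeight_mul_re_inner_galerkinField_le` — the weighted field inequality
  `∑_{k∈S} 4π²(|k|² - m) Re⟪c k, V(g,c) k⟫ ≤ -4π²mν ∑_{k∈S} 4π²(|k|² - m)‖c k‖²` for force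
  coefficients supported on the shell `|k|² = m`;
* `galerkin_shellExcess_le_mul_exp` — along every Galerkin solution,
  `ξ(t) ≤ ξ(s) e^{-8π²mν(t-s)}` for `0 ≤ s ≤ t`;
* `galerkin_shellExcess_nonpos` — in particular `ξ(s) ≤ 0 ⇒ ξ(t) ≤ 0` (the constraint is
  invariant), and `galerkin_enstrophy_le_of_shellExcess_nonpos` — then
  `∑ 4π²|k|²‖α t k‖² ≤ 4π²m ∑ ‖α t k‖²` (enstrophy `≤ λ ×` energy).

## References

* C. V. Tran, T. G. Shepherd, Physica D 165 (2002) 199–212, §4. [`TranShepherd2002`]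
* P. Constantin, C. Foias, O. P. Manley, Phys. Fluids 6 (1994) 427–429. [`ConstantinFoiasManley1994`]
* A. Alexakis, C. R. Doering, Phys. Lett. A 359 (2006) 652–657, §4. [`AlexakisDoering2006`]
* C. Foias, O. Manley, R. Rosa, R. Temam, *Navier–Stokes Equations and Turbulence*, CUP 2001,
  App. III.A.4 (A.32).
-/

open MeasureTheory Set Filter Topology UnitAddTorus
open scoped ENNReal NNReal InnerProductSpace

noncomputable section

namespace Literature.Barriers.AnomalousDissipation

open Literature.Analysis.FunctionSpaces Literature.Analysis.FunctionSpaces.Torus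
open Literature.Analysis.FluidPDE Literature.Analysis.FluidPDE.Torus

section Weighted

variable {S : Finset (Fin 2 → ℤ)}

/-- **The shell-weighted Galerkin field (any shell).** Let `S ⊂ ℤ²` be symmetric, `c`
conjugate symmetric and transversal on `S`, `ν ≥ 0`, `m ∈ ℝ`, and let the force coefficients
`g` live on the shell `|k|² = m` (`g k = 0` unless `|k|² = m`). Then, with the signed weight
`w_m(k) = 4π²(|k|² - m)`,
`∑_{k∈S} w_m(k) Re ⟪c k, V(g,c) k⟫ ≤ -(4π²m ν) ∑_{k∈S} w_m(k) ‖c k‖²`, `V = Torus.galerkinField ν S g c`: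
the force drops out (`w_m = 0` on its shell — "`(f, Au) = λ(f, u)`"), the convection drops out
(`∑ |k|² Re⟪c_k, 𝓕[(u·∇)u]_k⟫ = ∑ Re⟪c_k, 𝓕[(u·∇)u]_k⟫ = 0`, (II.A.62) and energy conservation),
and the Stokes part satisfies `-ν ∑ w_m 4π²|k|² ‖c_k‖² ≤ -4π²mν ∑ w_m ‖c_k‖²` termwise, since
`ν w_m(k)(4π²|k|² - 4π²m)‖c_k‖² = ν w_m(k)² ‖c_k‖² ≥ 0` (Tran–Shepherd 2002, §4, eq. (ξ)). [cite: TranShepherd2002, §4 eq. (ξ)] -/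
theorem sum_shellWeight_mul_re_inner_galerkinField_le {ν : ℝ} (hν : 0 ≤ ν)
    (hS : ∀ k ∈ S, -k ∈ S) {g c : (Fin 2 → ℤ) → EuclideanSpace ℂ (Fin 2)} (hc : IsConjSymm c) (hcT : IsTransversal S c)
    (m : ℝ) (hgm : ∀ k, freqNormSq k ≠ m → g k = 0) :
    ∑ k ∈ S, (4 * Real.pi ^ 2 * (freqNormSq k - m)) * (inner ℂ (c k) (galerkinField ν S g c k)).re ≤
      -(4 * Real.pi ^ 2 * m * ν) * ∑ k ∈ S, (4 * Real.pi ^ 2 * (freqNormSq k - m)) * ‖c k‖ ^ 2 := by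
  -- split the field
  have hsplit : ∀ k ∈ S, (inner ℂ (c k) (galerkinField ν S g c k)).re =
      -(ν * (4 * Real.pi ^ 2 * (freqNormSq k * ‖c k‖ ^ 2))) +
        ((inner ℂ (c k) (g k)).re - (inner ℂ (c k) (convectionCoeff S c c k)).re) := by
    intro k hk
    rw [galerkinField, inner_add_right, Complex.add_re, inner_leraySym_right_of_transversal _ _
      (hcT k hk), inner_sub_right, Complex.sub_re, inner_neg_right, Complex.neg_re,
      inner_smul_right, Complex.re_ofReal_mul]
    have hcc : (inner ℂ (c k) (c k)).re = ‖c k‖ ^ 2 := inner_self_eq_norm_sq (𝕜 := ℂ) (c k)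
    rw [hcc]
    ring
  have hsum : ∑ k ∈ S, (4 * Real.pi ^ 2 * (freqNormSq k - m)) * (inner ℂ (c k) (galerkinField ν S g c k)).re =
      (∑ k ∈ S, -(ν * ((4 * Real.pi ^ 2 * (freqNormSq k - m)) * (4 * Real.pi ^ 2 * freqNormSq k) * ‖c k‖ ^ 2))) +
        (∑ k ∈ S, (4 * Real.pi ^ 2 * (freqNormSq k - m)) * (inner ℂ (c k) (g k)).re) -
          ∑ k ∈ S, (4 * Real.pi ^ 2 * (freqNormSq k - m)) * (inner ℂ (c k) (convectionCoeff S c c k)).re := by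
    rw [← Finset.sum_add_distrib, ← Finset.sum_sub_distrib]
    refine Finset.sum_congr rfl fun k hk => ?_
    rw [hsplit k hk]
    ring
  -- the force drops out
  have hforce : ∑ k ∈ S, (4 * Real.pi ^ 2 * (freqNormSq k - m)) * (inner ℂ (c k) (g k)).re = 0 := by
    refine Finset.sum_eq_zero fun k _ => ?_
    by_cases h1 : freqNormSq k = m
    · rw [h1, sub_self, mul_zero, zero_mul]
    · rw [hgm k h1, inner_zero_right, Complex.zero_re, mul_zero]
  -- the convection drops out
  have hconv : ∑ k ∈ S, (4 * Real.pi ^ 2 * (freqNormSq k - m)) *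
      (inner ℂ (c k) (convectionCoeff S c c k)).re = 0 := by
    have hterm : ∀ k ∈ S, (4 * Real.pi ^ 2 * (freqNormSq k - m)) *
        (inner ℂ (c k) (convectionCoeff S c c k)).re =
        4 * Real.pi ^ 2 * (freqNormSq k * (inner ℂ (c k) (convectionCoeff S c c k)).re) -
          4 * Real.pi ^ 2 * m * (inner ℂ (c k) (convectionCoeff S c c k)).re := by
      intro k _
      ring
    rw [Finset.sum_congr rfl hterm, Finset.sum_sub_distrib, ← Finset.mul_sum, ← Finset.mul_sum,
      sum_freqNormSq_mul_re_inner_convectionCoeff_eq_zero hS hc hcT,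
      sum_re_inner_convectionCoeff_eq_zero hS hc hcT, mul_zero, mul_zero, sub_zero]
  rw [hsum, hforce, hconv, add_zero, sub_zero, Finset.mul_sum]
  refine Finset.sum_le_sum fun k _ => ?_
  -- termwise: `-ν w λ_k ‖c‖² ≤ -λ ν w ‖c‖²` since `ν (w)² ‖c‖² ≥ 0`, `λ_k - λ = w`
  have hc2 := sq_nonneg ‖c k‖
  have hkey : 0 ≤ ν * (4 * Real.pi ^ 2 * (freqNormSq k - m)) ^ 2 * ‖c k‖ ^ 2 := by positivity
  nlinarith

end Weighted

section GalerkinSolution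

variable {S : Finset (Fin 2 → ℤ)} {ν : ℝ} {g : ↥S → EuclideanSpace ℂ (Fin 2)} {α : ℝ → ↥S → EuclideanSpace ℂ (Fin 2)}

/-- **Tran–Shepherd's dynamical constraint at the Galerkin level (any shell).** Along a
Galerkin solution `α` on `𝕋²` with `ν ≥ 0` and force coefficients supported on the shell
`|k|² = m` (`m ∈ ℝ` arbitrary), the signed shell excess
`ξ(τ) = ∑_k 4π²(|k|² - m) ‖α τ k‖²` (`= ‖u‖² - λ|u|²`, `λ = 4π²m`) satisfies
`ξ(t) ≤ ξ(s) e^{-8π²mν (t-s)}` for `0 ≤ s ≤ t`, with no sign condition on `ξ`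
(`dξ/dt = 2∑ w_m Re⟪α_k, V_k⟫ ≤ -2νλ ξ`, `sum_shellWeight_mul_re_inner_galerkinField_le`, and the
one-sided Gronwall lemma `le_mul_exp_neg_of_hasDerivWithinAt_le`). For `m = 1` and mean-free
data this is the decay (A.32)–(A.33) behind Marchioro's theorem; for `m > 1` it is the
printed constraint that enstrophy cannot exceed `λ ×` energy by more than an exponentially
decaying transient (Tran–Shepherd 2002, §4). [cite: TranShepherd2002, §4 eq. (ξ) and (constraint)] -/
theorem galerkin_shellExcess_le_mul_exp (hν : 0 ≤ ν) (hS : ∀ k ∈ S, -k ∈ S)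
    (hmem : ∀ t, α t ∈ galerkinSubspace S)
    (hα : ∀ T, ∀ t ∈ Icc 0 T, HasDerivWithinAt α (galerkinRHS S ν g (α t)) (Icc 0 T) t)
    (m : ℝ) (hgm : ∀ k : ↥S, freqNormSq (k : Fin 2 → ℤ) ≠ m → g k = 0) {s t : ℝ} (hs : 0 ≤ s) (hst : s ≤ t) :
    ∑ k : ↥S, (4 * Real.pi ^ 2 * (freqNormSq (k : Fin 2 → ℤ) - m)) * ‖α t k‖ ^ 2 ≤
      (∑ k : ↥S, (4 * Real.pi ^ 2 * (freqNormSq (k : Fin 2 → ℤ) - m)) * ‖α s k‖ ^ 2) *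
        Real.exp (-(8 * Real.pi ^ 2 * m * ν) * (t - s)) := by
  have hgm' : ∀ k : Fin 2 → ℤ, freqNormSq k ≠ m → coeffExt S g k = 0 := by
    intro k hk
    by_cases hkS : k ∈ S
    · rw [coeffExt_of_mem _ hkS]; exact hgm ⟨k, hkS⟩ hk
    · exact coeffExt_of_not_mem _ hkS
  have hderiv : ∀ τ ∈ Icc 0 t, HasDerivWithinAt
      (fun σ => ∑ k : ↥S, (4 * Real.pi ^ 2 * (freqNormSq (k : Fin 2 → ℤ) - m)) * ‖α σ k‖ ^ 2)
      (∑ k : ↥S, (4 * Real.pi ^ 2 * (freqNormSq (k : Fin 2 → ℤ) - m)) *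
        (2 * (inner ℂ (α τ k) (galerkinRHS S ν g (α τ) k)).re)) (Icc 0 t) τ :=
    fun τ hτ => hasDerivWithinAt_sum_mul_norm_sq (hα t τ hτ) fun k => 4 * Real.pi ^ 2 * (freqNormSq (k : Fin 2 → ℤ) - m)
  have hle : ∀ τ ∈ Icc 0 t,
      ∑ k : ↥S, (4 * Real.pi ^ 2 * (freqNormSq (k : Fin 2 → ℤ) - m)) *
          (2 * (inner ℂ (α τ k) (galerkinRHS S ν g (α τ) k)).re) ≤
        -(8 * Real.pi ^ 2 * m * ν) *
          ∑ k : ↥S, (4 * Real.pi ^ 2 * (freqNormSq (k : Fin 2 → ℤ) - m)) * ‖α τ k‖ ^ 2 := by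
    intro τ _
    have h := sum_shellWeight_mul_re_inner_galerkinField_le hν hS ((hmem τ).1.isConjSymm_coeffExt hS)
      (hmem τ).2.isTransversal_coeffExt m hgm'
    rw [sum_coeffExt (fun k v => (4 * Real.pi ^ 2 * (freqNormSq k - m)) *
        (inner ℂ v (galerkinField ν S (coeffExt S g) (coeffExt S (α τ)) k)).re),
      sum_coeffExt (fun k v => (4 * Real.pi ^ 2 * (freqNormSq k - m)) * ‖v‖ ^ 2)] at h
    have h2 : ∑ k : ↥S, (4 * Real.pi ^ 2 * (freqNormSq (k : Fin 2 → ℤ) - m)) *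
          (2 * (inner ℂ (α τ k) (galerkinRHS S ν g (α τ) k)).re) =
        2 * ∑ k : ↥S, (4 * Real.pi ^ 2 * (freqNormSq (k : Fin 2 → ℤ) - m)) *
          (inner ℂ (α τ k) (galerkinField ν S (coeffExt S g) (coeffExt S (α τ)) k)).re := by
      rw [Finset.mul_sum]
      refine Finset.sum_congr rfl fun k _ => ?_
      rw [galerkinRHS_apply]
      ring
    rw [h2]
    linarith
  exact le_mul_exp_neg_of_hasDerivWithinAt_le hderiv hle hs hst le_rfl

/-- **Invariance of the dynamical constraint.** If the signed shell excess is non-positive at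
time `s ≥ 0` it stays non-positive: `ξ(s) ≤ 0 ⇒ ξ(t) ≤ 0` for `t ≥ s` ("a non-positive value
will evolve but remain non-positive for all time", Tran–Shepherd 2002, §4). [cite: TranShepherd2002, §4 after eq. (ξ)] -/
theorem galerkin_shellExcess_nonpos (hν : 0 ≤ ν) (hS : ∀ k ∈ S, -k ∈ S)
    (hmem : ∀ t, α t ∈ galerkinSubspace S)
    (hα : ∀ T, ∀ t ∈ Icc 0 T, HasDerivWithinAt α (galerkinRHS S ν g (α t)) (Icc 0 T) t)
    (m : ℝ) (hgm : ∀ k : ↥S, freqNormSq (k : Fin 2 → ℤ) ≠ m → g k = 0) {s t : ℝ} (hs : 0 ≤ s) (hst : s ≤ t)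
    (h0 : ∑ k : ↥S, (4 * Real.pi ^ 2 * (freqNormSq (k : Fin 2 → ℤ) - m)) * ‖α s k‖ ^ 2 ≤ 0) :
    ∑ k : ↥S, (4 * Real.pi ^ 2 * (freqNormSq (k : Fin 2 → ℤ) - m)) * ‖α t k‖ ^ 2 ≤ 0 :=
  (galerkin_shellExcess_le_mul_exp hν hS hmem hα m hgm hs hst).trans
    (mul_nonpos_of_nonpos_of_nonneg h0 (Real.exp_pos _).le)

/-- **Enstrophy is slaved below `λ ×` energy.** Under the dynamical constraint `ξ(t) ≤ 0` the
Galerkin enstrophy is at most `4π²m` times the Galerkin energy: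
`∑_k 4π²|k|² ‖α t k‖² ≤ 4π²m ∑_k ‖α t k‖²` (Tran–Shepherd 2002, §4, (constraint):
`‖u‖₁² ≤ λ_s‖u‖²`). [cite: TranShepherd2002, §4 (constraint)] -/
theorem galerkin_enstrophy_le_of_shellExcess_nonpos (m : ℝ) {c : ↥S → EuclideanSpace ℂ (Fin 2)}
    (h : ∑ k : ↥S, (4 * Real.pi ^ 2 * (freqNormSq (k : Fin 2 → ℤ) - m)) * ‖c k‖ ^ 2 ≤ 0) :
    ∑ k : ↥S, 4 * Real.pi ^ 2 * freqNormSq (k : Fin 2 → ℤ) * ‖c k‖ ^ 2 ≤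
      4 * Real.pi ^ 2 * m * ∑ k : ↥S, ‖c k‖ ^ 2 := by
  have hexp : ∑ k : ↥S, (4 * Real.pi ^ 2 * (freqNormSq (k : Fin 2 → ℤ) - m)) * ‖c k‖ ^ 2 =
      ∑ k : ↥S, 4 * Real.pi ^ 2 * freqNormSq (k : Fin 2 → ℤ) * ‖c k‖ ^ 2 -
        4 * Real.pi ^ 2 * m * ∑ k : ↥S, ‖c k‖ ^ 2 := by
    rw [Finset.mul_sum, ← Finset.sum_sub_distrib]
    refine Finset.sum_congr rfl fun k _ => ?_
    ring
  rw [hexp] at h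
  linarith

end GalerkinSolution

end Literature.Barriers.AnomalousDissipation

end
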